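import Summits.Parity.GeneralizedHardyLittlewood.Theorems.LeeYangFibresAbsoluteUpgradeUniformDefs
import Summits.Parity.GeneralizedHardyLittlewood.Theorems.LeeYangFibresRelativeDimOneDegenerateCount
import Summits.Parity.GeneralizedHardyLittlewood.Theorems.LeeYangFibresRelativeDimOneSingularTail
import HarnessLib

/-!
# Route `LeeYangFibres`, crux `AbsoluteUpgrade` (stmt-Parity-14116), line `Sketch` (uniform amplification):
# C = `CollisionFormFacts` (the collision forms of translate-constellations)

For a `t`-system `Ψ` of one-dimensional forms `ψ_i(n) = a_i n + b_i` and a shift `H ∈ ℤ^m` (shift vector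
`H' = shiftVec H = (0, H₁, …, H_m)`), the COLLISION FORM of the pair of translated forms `ψ_i(· + H'_j)`,
`ψ_{i'}(· + H'_{j'})` is `Δ_{j,j',i,i'}(H) = a_i a_{i'} (H'_j − H'_{j'}) + (a_{i'} b_i − a_i b_{i'})`
(`collisionForm Ψ H j j' i i'`); it is the constant `a_{i'} ψ_i(n + H'_j) − a_i ψ_{i'}(n + H'_{j'})`
(`sub_eval_eq_collisionForm`). We prove the three clauses of `CollisionFormFacts`:

1. the EXPLICIT degenerate count `#{H ∈ [-2N,2N]^m : Ψ^{(H)} degenerate} ≤ m (m+1) t² (4N+1)^{m-1}` for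
   non-degenerate `Ψ` (the landed argument of `stub_degenerateCount` with its constant exposed: the degenerate
   shifts lie on `m (m+1) t²` hyperplanes `exists_hyperplane_of_degenerate`, each with `≤ (4N+1)^{m-1}` points in
   the box, `card_filter_hyperplane_le`) — `card_filter_not_nondegenerate_le`;
2. the collision forms with `j ≠ j'` of a NON-DEGENERATE translate-constellation do not vanish (a vanishing one is
   a proportionality `a_{i'} ψ_i(· + H'_j) = a_i ψ_{i'}(· + H'_{j'})` between two distinct forms of `Ψ^{(H)}`) —
   `collisionForm_ne_zero`;
3. `|Δ_{j,j',i,i'}(H)| ≤ 6 L² N` for `‖Ψ‖_N ≤ L`, `N ≥ 1`, `H ∈ [-2N,2N]^m` (`|a_i| ≤ L`, `|b_i| ≤ L N`,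
   `|H'_j − H'_{j'}| ≤ 4N`) — `natAbs_collisionForm_le`.

References: B. Green, T. Tao, Ann. of Math. 171 (2010), Def. 1.1 [GreenTao2010]; P. X. Gallagher, Mathematika 23
(1976), §2 [Gallagher1976].
-/

noncomputable section

open scoped BigOperators Classical Topology
open Finset Filter MeasureTheory Literature.NumberTheory.Sieve
open Summit.Parity.GeneralizedHardyLittlewood.Cruxes.RelativeDimOne.TranslateAmplification

namespace Summit.Parity.GeneralizedHardyLittlewood.Cruxes.AbsoluteUpgrade.UniformAmplification

variable {t m : ℕ}

/-! ### The collision form is a constant combination of two translated forms -/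

/-- THE RING IDENTITY behind everything: `a_{i'} ψ_i(n + H'_j) − a_i ψ_{i'}(n + H'_{j'}) = Δ_{j,j',i,i'}(H)`
identically in `n`. [folklore] -/
theorem sub_eval_eq_collisionForm (Ψ : Fin t → AffLinForm 1) (H : Fin m → ℤ) (j j' : Fin (m + 1))
    (i i' : Fin t) (n : Fin 1 → ℤ) :
    (Ψ i').coeff 0 * (translateFamily Ψ H (finProdFinEquiv (j, i))).eval n -
        (Ψ i).coeff 0 * (translateFamily Ψ H (finProdFinEquiv (j', i'))).eval n =
      collisionForm Ψ H j j' i i' := by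
  rw [translateFamily_eval, translateFamily_eval, collisionForm]
  ring

/-- The leading coefficient of the form `(j, i)` of `Ψ^{(H)}` is `a_i`. [folklore] -/
theorem coeff_translateFamily (Ψ : Fin t → AffLinForm 1) (H : Fin m → ℤ) (j : Fin (m + 1)) (i : Fin t) :
    (translateFamily Ψ H (finProdFinEquiv (j, i))).coeff 0 = (Ψ i).coeff 0 := by
  rw [translateFamily_apply]
  rfl

/-! ### C(2): non-vanishing of the collision forms of a non-degenerate translate-constellation -/

/-- **C(2).** If `Ψ^{(H)}` is non-degenerate then `Δ_{j,j',i,i'}(H) ≠ 0` for `j ≠ j'`: otherwise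
`a_{i'} ψ_i(· + H'_j) = a_i ψ_{i'}(· + H'_{j'})` is a proportionality between the two DISTINCT forms `(j,i) ≠ (j',i')`
of `Ψ^{(H)}`, so `a_{i'} = a_i = 0` by non-degeneracy, contradicting `a_i ≠ 0`. [cite: GreenTao2010, Def. 1.1] -/
theorem collisionForm_ne_zero (Ψ : Fin t → AffLinForm 1) (H : Fin m → ℤ)
    (hH : IsNondegenerateSystem (translateFamily Ψ H)) {j j' : Fin (m + 1)} (i i' : Fin t) (hjj' : j ≠ j') :
    collisionForm Ψ H j j' i i' ≠ 0 := by
  intro h0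
  have hkk' : finProdFinEquiv (j, i) ≠ finProdFinEquiv (j', i') := fun h =>
    hjj' (congr_arg Prod.fst (finProdFinEquiv.injective h))
  have hprop := hH.2 _ _ hkk' ((Ψ i').coeff 0) ((Ψ i).coeff 0) fun n =>
    sub_eq_zero.mp ((sub_eval_eq_collisionForm Ψ H j j' i i' n).trans h0)
  have hA : (translateFamily Ψ H (finProdFinEquiv (j, i))).coeff 0 ≠ 0 := coeff_zero_ne_zero hH _
  rw [coeff_translateFamily] at hA
  exact hA hprop.2

/-! ### C(3): the size of the collision forms on the shift box -/

/-- On the shift box `[-2N, 2N]^m` every entry of the shift vector has `|H'_j| ≤ 2N` (`H'_0 = 0`). [folklore] -/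
theorem natAbs_shiftVec_le {N : ℕ} {H : Fin m → ℤ} (hH : H ∈ shiftBox m N) (j : Fin (m + 1)) :
    (shiftVec H j).natAbs ≤ 2 * N := by
  rw [shiftBox, Fintype.mem_piFinset] at hH
  cases j using Fin.cases with
  | zero => simp
  | succ j₀ =>
    rw [shiftVec_succ]
    have h := Finset.mem_Icc.mp (hH j₀)
    omega

/-- **C(3).** `|Δ_{j,j',i,i'}(H)| ≤ 6 L² N` for `‖Ψ‖_N ≤ L`, `N ≥ 1` and `H ∈ [-2N,2N]^m`: `|a_i| ≤ L`, `|b_i| ≤ L N`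
(`natAbs_coeff_le_of_affLinSize_le`, `natAbs_crossDisc_le`) and `|H'_j − H'_{j'}| ≤ 4N`. [folklore] -/
theorem natAbs_collisionForm_le (Ψ : Fin t → AffLinForm 1) (H : Fin m → ℤ) {N L : ℕ} (hN : 1 ≤ N)
    (hL : affLinSize Ψ N ≤ L) (hH : H ∈ shiftBox m N) (j j' : Fin (m + 1)) (i i' : Fin t) :
    ((collisionForm Ψ H j j' i i').natAbs : ℝ) ≤ 6 * (L : ℝ) ^ 2 * N := by
  have ha : ∀ i, ((Ψ i).coeff 0).natAbs ≤ L := fun i => natAbs_coeff_le_of_affLinSize_le hL i 0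
  have hsv : (shiftVec H j - shiftVec H j').natAbs ≤ 4 * N := by
    have h1 := natAbs_shiftVec_le hH j
    have h2 := natAbs_shiftVec_le hH j'
    omega
  have hnat : (collisionForm Ψ H j j' i i').natAbs ≤ 6 * L ^ 2 * N := by
    calc (collisionForm Ψ H j j' i i').natAbs
        ≤ ((Ψ i).coeff 0 * (Ψ i').coeff 0 * (shiftVec H j - shiftVec H j')).natAbs +
            ((Ψ i').coeff 0 * (Ψ i).const - (Ψ i).coeff 0 * (Ψ i').const).natAbs := Int.natAbs_add_le _ _
      _ ≤ L * L * (4 * N) + 2 * L ^ 2 * N := by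
          refine add_le_add ?_ (SingularTailProof.natAbs_crossDisc_le hN hL i' i)
          rw [Int.natAbs_mul, Int.natAbs_mul]
          exact Nat.mul_le_mul (Nat.mul_le_mul (ha i) (ha i')) hsv
      _ = 6 * L ^ 2 * N := by ring
  have hcast : ((collisionForm Ψ H j j' i i').natAbs : ℝ) ≤ ((6 * L ^ 2 * N : ℕ) : ℝ) := by exact_mod_cast hnat
  push_cast at hcast
  exact hcast

/-! ### C(1): the explicit degenerate count -/

/-- **C(1)** (the landed `stub_degenerateCount` with its constant exposed): for non-degenerate `Ψ`, the shifts
`H ∈ [-2N,2N]^m` with `Ψ^{(H)}` degenerate number at most `m (m+1) t² (4N+1)^{m-1}` — they lie on the union over the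
index tuples `(j₀, j', i, i')` (`j' ≠ j₀ + 1`) of the hyperplanes of `exists_hyperplane_of_degenerate`, each with at
most `(4N+1)^{m-1}` points in the box (`card_filter_hyperplane_le`); for `m = 0` there are none. [cite: GreenTao2010, Def. 1.1] -/
theorem card_filter_not_nondegenerate_le (m t N : ℕ) (Ψ : Fin t → AffLinForm 1) (hΨ : IsNondegenerateSystem Ψ) :
    (((shiftBox m N).filter (fun H => ¬ IsNondegenerateSystem (translateFamily Ψ H))).card : ℝ) ≤
      (m : ℝ) * (m + 1) * (t : ℝ) ^ 2 * ((4 * N + 1 : ℕ) : ℝ) ^ (m - 1) := by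
  -- adapted from `stub_degenerateCount` (Theorems/LeeYangFibresRelativeDimOneDegenerateCount.lean)
  cases m with
  | zero =>
    have h0 : ∀ H ∈ shiftBox 0 N, ¬¬IsNondegenerateSystem (translateFamily Ψ H) :=
      fun H _ hH => (exists_hyperplane_of_degenerate Ψ hΨ H hH).elim fun j₀ _ => j₀.elim0
    rw [Finset.filter_false_of_mem h0]
    simp
  | succ m₀ =>
    have hA := coeff_zero_ne_zero hΨ
    -- the hyperplane slices of the shift box, indexed by `(j₀, j', i, i')`
    set slice : (Fin (m₀ + 1) × Fin (m₀ + 1 + 1)) × (Fin t × Fin t) → Finset (Fin (m₀ + 1) → ℤ) :=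
      fun x => (shiftBox (m₀ + 1) N).filter (fun H => x.1.2 ≠ x.1.1.succ ∧
        (Ψ x.2.1).coeff 0 * (Ψ x.2.2).coeff 0 * (H x.1.1 - shiftVec H x.1.2) =
          (Ψ x.2.1).coeff 0 * (Ψ x.2.2).const - (Ψ x.2.2).coeff 0 * (Ψ x.2.1).const) with hslice
    -- every slice is small
    have hcard : ∀ x, (slice x).card ≤ (4 * N + 1) ^ m₀ := by
      rintro ⟨⟨j₀, j'⟩, ⟨i, i'⟩⟩
      rw [hslice]
      dsimp only
      by_cases hj : j' = j₀.succ
      · rw [Finset.filter_false_of_mem, Finset.card_empty]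
        · exact Nat.zero_le _
        · exact fun H _ h => h.1 hj
      · refine le_trans (Finset.card_le_card fun H hH => ?_)
          (card_filter_hyperplane_le m₀ N (mul_ne_zero (hA i) (hA i'))
            ((Ψ i).coeff 0 * (Ψ i').const - (Ψ i').coeff 0 * (Ψ i).const) j₀ j' hj)
        rw [Finset.mem_filter] at hH ⊢
        exact ⟨hH.1, hH.2.2⟩
    -- the degenerate shifts lie on the slices
    have hnat : ((shiftBox (m₀ + 1) N).filter
        (fun H => ¬ IsNondegenerateSystem (translateFamily Ψ H))).card ≤
        (m₀ + 1) * (m₀ + 1 + 1) * (t * t) * (4 * N + 1) ^ m₀ := by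
      calc ((shiftBox (m₀ + 1) N).filter
              (fun H => ¬ IsNondegenerateSystem (translateFamily Ψ H))).card
          ≤ (Finset.univ.biUnion slice).card := by
            refine Finset.card_le_card fun H hH => ?_
            rw [Finset.mem_filter] at hH
            obtain ⟨j₀, j', i, i', hj, hEq⟩ := exists_hyperplane_of_degenerate Ψ hΨ H hH.2
            rw [Finset.mem_biUnion]
            refine ⟨((j₀, j'), (i, i')), Finset.mem_univ _, ?_⟩
            rw [hslice]
            dsimp only
            rw [Finset.mem_filter]
            exact ⟨hH.1, hj, hEq⟩
        _ ≤ ∑ x, (slice x).card := Finset.card_biUnion_le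
        _ ≤ ∑ _x : (Fin (m₀ + 1) × Fin (m₀ + 1 + 1)) × (Fin t × Fin t), (4 * N + 1) ^ m₀ :=
            Finset.sum_le_sum fun x _ => hcard x
        _ = (m₀ + 1) * (m₀ + 1 + 1) * (t * t) * (4 * N + 1) ^ m₀ := by
            rw [Finset.sum_const, Finset.card_univ, smul_eq_mul]
            simp only [Fintype.card_prod, Fintype.card_fin]
    rw [Nat.add_sub_cancel]
    have hcast : ((((shiftBox (m₀ + 1) N).filter
        (fun H => ¬ IsNondegenerateSystem (translateFamily Ψ H))).card : ℕ) : ℝ) ≤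
        (((m₀ + 1) * (m₀ + 1 + 1) * (t * t) * (4 * N + 1) ^ m₀ : ℕ) : ℝ) := by exact_mod_cast hnat
    refine hcast.trans_eq ?_
    push_cast
    ring

/-! ### C assembled -/

/-- **C = `CollisionFormFacts` holds** (registered sub-goal of stub `stub_collisionFormFactsAndTail` of the line
`Sketch`): the explicit degenerate count `≤ m (m+1) t² (4N+1)^{m-1}`, the non-vanishing of the collision forms with
`j ≠ j'` of a non-degenerate translate-constellation, and the size bound `|Δ| ≤ 6 L² N` on the shift box.
[cite: GreenTao2010, Def. 1.1] -/
theorem collisionFormFacts : CollisionFormFacts := by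
  unfold CollisionFormFacts
  refine ⟨fun m t N Ψ hΨ => card_filter_not_nondegenerate_le m t N Ψ hΨ,
    fun m t Ψ H hH j j' i i' hjj' => collisionForm_ne_zero Ψ H hH i i' hjj',
    fun m t N L Ψ H hN hL hH j j' i i' => natAbs_collisionForm_le Ψ H hN hL hH j j' i i'⟩

end Summit.Parity.GeneralizedHardyLittlewood.Cruxes.AbsoluteUpgrade.UniformAmplification

end
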